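import Summits.AnomalousDissipation.AnomalousDissipation.Theorems.MarginalStabilityChainStrainedLayerLawStubVorticityUniformBoundsE
import Literature.Analysis.FluidPDE.Seregin2020SwirlMoserProfile

/-!
# Stub `stub_vorticityUniformBounds` (crux stmt-AnomalousDissipation-3007, line `strain-work-sum-rule`) — tools P:
# the weighted Kato balance (equality form) and the weight `φ = √(1 + y²)`

Support file (`--supports stmt-AnomalousDissipation-3007`; registered sub-goal `stub_vorticityUniformBounds_katoWeighted`).
`stub_vorticityUniformBounds_katoWeighted`: for `Φ = j_ε′(ω)ψ(y)` with an arbitrary `C¹` weight `ψ` of compact `y`-support,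
`∫∫ j_ε′(ω)ψ(∂ₓb − ∂_ya) = ∫∫ G_ε(ω)ψ + ∫∫ j_ε(ω)(v − y)ψ′ − ν∫∫ j_ε″(ω)|∇ω|²ψ − ν∫∫ j_ε′(ω)∂_yω ψ′` (tools E proved the
crude bound; the moment step needs the signed transport term). Second part: the calculus of the weight
`φ(y) = √(1 + y²)` (`φ ≥ max(1, |y|)`, `φ ≤ 1 + |y|`, `φ′ = y/φ`, `|φ′| ≤ 1`, `φ″ = φ⁻³ ≤ 1`, `yφ′ = φ − 1/φ`).
All `[folklore]`.
-/

-- `Summit.<Summit>.<Problem>` is the tree's mandated summit-side namespace (CONVENTIONS §2); for this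
-- single-conjunct summit the two coincide, so the duplicate is deliberate.
set_option linter.dupNamespace false

noncomputable section

open scoped Topology ENNReal
open Filter Set Function MeasureTheory

namespace Summit.AnomalousDissipation.AnomalousDissipation.Theorems.StrainedLayerLaw.StrainWorkSumRule

open Literature.Analysis.FluidPDE Literature.Analysis.FluidPDE.StretchedLayer
open Summit.AnomalousDissipation.AnomalousDissipation.Theorems.MarginalStabilityChainStretchedVortexRows

/-! ## The weighted Kato balance at one instant (equality form) -/

section KatoWeighted

/-- **Weighted Kato balance, equality form (registered sub-goal `stub_vorticityUniformBounds_katoWeighted`).** In the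
setting of tools D/E, for `Φ = j_ε′(ω)ψ(y)` with an arbitrary `C¹` weight `ψ` vanishing for `|y| ≥ R`:
`∫∫ j_ε′(ω)ψ(∂ₓb − ∂_ya) = ∫∫ G_ε(ω)ψ + ∫∫ j_ε(ω)(v − y)ψ′ − ν∫∫ j_ε″(ω)|∇ω|²ψ − ν∫∫ j_ε′(ω)∂_yω ψ′`
(`G_ε = −ε²/√(s² + ε²)`, `j_ε″ = ε²/((s² + ε²)√(s² + ε²))`); tools E bound the right-hand side crudely, the moment
bound (tools Q) needs the signed transport term. [folklore] -/
theorem stub_vorticityUniformBounds_katoWeighted : ∀ (L ν R ε : ℝ) (u v p a b : ℝ → ℝ → ℝ) (ψ : ℝ → ℝ),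
    0 < L → 0 < ε →
    ContDiff ℝ 2 (fun q : ℝ × ℝ => u q.1 q.2) → ContDiff ℝ 2 (fun q : ℝ × ℝ => v q.1 q.2) →
    ContDiff ℝ 1 (fun q : ℝ × ℝ => p q.1 q.2) → ContDiff ℝ 1 (fun q : ℝ × ℝ => a q.1 q.2) →
    ContDiff ℝ 1 (fun q : ℝ × ℝ => b q.1 q.2) →
    (∀ x y, a x y + u x y * dX u x y + (v x y - y) * dY u x y = -dX p x y + ν * lap u x y) →
    (∀ x y, b x y + u x y * dX v x y + (v x y - y) * dY v x y - v x y = -dY p x y + ν * lap v x y) →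
    (∀ x y, dX u x y + dY v x y = 0) →
    (∀ x y, u (x + L) y = u x y) → (∀ x y, v (x + L) y = v x y) → (∀ x y, p (x + L) y = p x y) →
    (∀ x y, b (x + L) y = b x y) →
    ContDiff ℝ 1 ψ → (∀ y, R ≤ |y| → ψ y = 0) →
      ∫ q in Ioc 0 L ×ˢ univ, vorticity u v q.1 q.2 / Real.sqrt (vorticity u v q.1 q.2 ^ 2 + ε ^ 2) * ψ q.2 *
          (dX b q.1 q.2 - dY a q.1 q.2) =
        (∫ q in Ioc 0 L ×ˢ univ, -ε ^ 2 / Real.sqrt (vorticity u v q.1 q.2 ^ 2 + ε ^ 2) * ψ q.2) +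
          (∫ q in Ioc 0 L ×ˢ univ, Real.sqrt (vorticity u v q.1 q.2 ^ 2 + ε ^ 2) * (v q.1 q.2 - q.2) * deriv ψ q.2) -
          ν * (∫ q in Ioc 0 L ×ˢ univ, ε ^ 2 / ((vorticity u v q.1 q.2 ^ 2 + ε ^ 2) *
            Real.sqrt (vorticity u v q.1 q.2 ^ 2 + ε ^ 2)) *
            (dX (vorticity u v) q.1 q.2 ^ 2 + dY (vorticity u v) q.1 q.2 ^ 2) * ψ q.2) -
          ν * ∫ q in Ioc 0 L ×ˢ univ, vorticity u v q.1 q.2 / Real.sqrt (vorticity u v q.1 q.2 ^ 2 + ε ^ 2) *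
            dY (vorticity u v) q.1 q.2 * deriv ψ q.2 := by
  obtain ⟨kato_sq_add_sq_pos, kato_sqrt_pos, kato_le_sqrt, kato_abs_le_sqrt, kato_sqrt_le, kato_abs_jprime_le_one,
    kato_jsecond_nonneg, kato_G_nonpos, kato_mul_jprime_sub_G, kato_hasDerivAt_j, kato_hasDerivAt_jprime,
    kato_hasDerivAt_G⟩ := kato_modulus_props
  intro L ν R ε u v p a b ψ hL hε hu hv hp ha hb hmx hmy hdiv huper hvper hpper hbper hψ hψR
  -- notation: `ω`, `j′`, `j″`, `G`, the test function `Φ = j′(ω) ψ`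
  set ω : ℝ → ℝ → ℝ := vorticity u v with hωdef
  set jp : ℝ → ℝ := fun s => s / Real.sqrt (s ^ 2 + ε ^ 2) with hjp
  set jpp : ℝ → ℝ := fun s => ε ^ 2 / ((s ^ 2 + ε ^ 2) * Real.sqrt (s ^ 2 + ε ^ 2)) with hjpp
  set G : ℝ → ℝ := fun s => -ε ^ 2 / Real.sqrt (s ^ 2 + ε ^ 2) with hG
  set Φ : ℝ → ℝ → ℝ := fun x y => jp (ω x y) * ψ y with hΦdef
  -- regularity
  have hu1 : ContDiff ℝ 1 (fun q : ℝ × ℝ => u q.1 q.2) := hu.of_le one_le_two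
  have hv1 : ContDiff ℝ 1 (fun q : ℝ × ℝ => v q.1 q.2) := hv.of_le one_le_two
  have hω1 : ContDiff ℝ 1 (fun q : ℝ × ℝ => ω q.1 q.2) := contDiff_one_vorticity hu hv
  have hjp1 : ContDiff ℝ 1 jp := by
    refine contDiff_id.div (ContDiff.sqrt (by fun_prop) fun s => (kato_sq_add_sq_pos hε s).ne') fun s => ?_
    exact (kato_sqrt_pos hε s).ne'
  have hG1 : ContDiff ℝ 1 G := by
    refine contDiff_const.div (ContDiff.sqrt (by fun_prop) fun s => (kato_sq_add_sq_pos hε s).ne') fun s => ?_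
    exact (kato_sqrt_pos hε s).ne'
  have hΦ1 : ContDiff ℝ 1 (fun q : ℝ × ℝ => Φ q.1 q.2) := (hjp1.comp hω1).mul (hψ.comp contDiff_snd)
  have cψ : Continuous ψ := hψ.continuous
  have cψ' : Continuous (deriv ψ) := hψ.continuous_deriv le_rfl
  have cu : Continuous fun q : ℝ × ℝ => u q.1 q.2 := hu.continuous
  have cv : Continuous fun q : ℝ × ℝ => v q.1 q.2 := hv.continuous
  have cux : Continuous fun q : ℝ × ℝ => dX u q.1 q.2 := continuous_dX hu1
  have cvy : Continuous fun q : ℝ × ℝ => dY v q.1 q.2 := continuous_dY hv1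
  have cω : Continuous fun q : ℝ × ℝ => ω q.1 q.2 := hω1.continuous
  have cωx : Continuous fun q : ℝ × ℝ => dX ω q.1 q.2 := continuous_dX hω1
  have cωy : Continuous fun q : ℝ × ℝ => dY ω q.1 q.2 := continuous_dY hω1
  have cjp : Continuous jp := hjp1.continuous
  have cjpp : Continuous jpp := by
    simp only [hjpp]
    exact continuous_const.div ((by fun_prop : Continuous fun s : ℝ => s ^ 2 + ε ^ 2).mul
      (Real.continuous_sqrt.comp (by fun_prop))) fun s => (mul_pos (kato_sq_add_sq_pos hε s) (kato_sqrt_pos hε s)).ne'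
  have cG : Continuous G := hG1.continuous
  have cΦx : Continuous fun q : ℝ × ℝ => dX Φ q.1 q.2 := continuous_dX hΦ1
  have cΦy : Continuous fun q : ℝ × ℝ => dY Φ q.1 q.2 := continuous_dY hΦ1
  -- periodicity and support of the test function
  have hωper : ∀ x y, ω (x + L) y = ω x y := fun x y => by
    simp only [hωdef, vorticity]; rw [dX_periodic hvper, dY_periodic huper]
  have hΦper : ∀ x y, Φ (x + L) y = Φ x y := fun x y => by simp only [hΦdef, hωper]
  have hΦ0 : ∀ x y, R ≤ |y| → Φ x y = 0 := fun x y hy => by simp only [hΦdef, hψR y hy, mul_zero]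
  have hψ'0 : ∀ y, R + 1 ≤ |y| → deriv ψ y = 0 := fun y hy =>
    kato_dY_eq_zero (Φ := fun _ s => ψ s) (x := (0:ℝ)) (fun _ s hs => hψR s hs) hy
  -- the slice derivatives of `Φ`
  have hωx : ∀ x y, HasDerivAt (fun s => ω s y) (dX ω x y) x := hasDerivAt_dX_of_contDiff hω1 one_ne_zero
  have hωy : ∀ x y, HasDerivAt (fun s => ω x s) (dY ω x y) y := hasDerivAt_dY_of_contDiff hω1 one_ne_zero
  have hψd : ∀ y, HasDerivAt ψ (deriv ψ y) y := fun y => (hψ.differentiable one_ne_zero y).hasDerivAt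
  have hjpd : ∀ s, HasDerivAt jp (jpp s) s := fun s => kato_hasDerivAt_jprime hε s
  have hΦx : ∀ x y, dX Φ x y = jpp (ω x y) * dX ω x y * ψ y := fun x y => by
    have h := (HasDerivAt.comp (h₂ := jp) (h := fun s => ω s y) x (hjpd (ω x y)) (hωx x y)).mul_const (ψ y)
    exact h.deriv
  have hΦy : ∀ x y, dY Φ x y = jpp (ω x y) * dY ω x y * ψ y + jp (ω x y) * deriv ψ y := fun x y => by
    have h := (HasDerivAt.comp (h₂ := jp) (h := fun s => ω x s) y (hjpd (ω x y)) (hωy x y)).mul (hψd y)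
    exact h.deriv
  -- the weak vorticity balance tested against `Φ`
  have key := stub_vorticityUniformBounds_weakVorticity L ν R u v p a b Φ hL hu hv hp ha hb hΦ1 hmx hmy hdiv
    huper hvper hpper hbper hΦper hΦ0
  rw [show (fun q : ℝ × ℝ => jp (vorticity u v q.1 q.2) * ψ q.2 * (dX b q.1 q.2 - dY a q.1 q.2)) =
    fun q : ℝ × ℝ => Φ q.1 q.2 * (dX b q.1 q.2 - dY a q.1 q.2) from rfl, key]
  -- integrability helpers: a factor `ψ` or `ψ′`
  have hIψ : ∀ F : ℝ × ℝ → ℝ, Continuous F →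
      IntegrableOn (fun q : ℝ × ℝ => F q * ψ q.2) (Ioc 0 L ×ˢ univ) := fun F hF =>
    kato_integrableOn_strip_of_eq_zero (R := R) (hF.mul (cψ.comp continuous_snd)) fun x _ y hy => by
      simp only [hψR y hy, mul_zero]
  have hIψ' : ∀ F : ℝ × ℝ → ℝ, Continuous F →
      IntegrableOn (fun q : ℝ × ℝ => F q * deriv ψ q.2) (Ioc 0 L ×ˢ univ) := fun F hF =>
    kato_integrableOn_strip_of_eq_zero (R := R + 1) (hF.mul (cψ'.comp continuous_snd)) fun x _ y hy => by
      simp only [hψ'0 y hy, mul_zero]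
  ------------------------------------------------------------------
  -- the transport part
  ------------------------------------------------------------------
  have hT : ∫ q in Ioc 0 L ×ˢ univ, ω q.1 q.2 * (u q.1 q.2 * dX Φ q.1 q.2 + (v q.1 q.2 - q.2) * dY Φ q.1 q.2) =
      (∫ q in Ioc 0 L ×ˢ univ, G (ω q.1 q.2) * ψ q.2) +
        ∫ q in Ioc 0 L ×ˢ univ, Real.sqrt (ω q.1 q.2 ^ 2 + ε ^ 2) * (v q.1 q.2 - q.2) * deriv ψ q.2 := by
    -- `G′(ω) ∇ω`
    have hGd : ∀ s, HasDerivAt G (s * jpp s) s := fun s => kato_hasDerivAt_G hε s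
    have hGx : ∀ x y, HasDerivAt (fun s => G (ω s y)) (ω x y * jpp (ω x y) * dX ω x y) x := fun x y =>
      HasDerivAt.comp (h₂ := G) (h := fun s => ω s y) x (hGd (ω x y)) (hωx x y)
    have hGy : ∀ x y, HasDerivAt (fun s => G (ω x s)) (ω x y * jpp (ω x y) * dY ω x y) y := fun x y =>
      HasDerivAt.comp (h₂ := G) (h := fun s => ω x s) y (hGd (ω x y)) (hωy x y)
    -- integration by parts in `x`: `∫∫ (uψ) ∂ₓG(ω) = −∫∫ (∂ₓu ψ) G(ω)`
    have ibx : ∫ q in Ioc 0 L ×ˢ univ, (u q.1 q.2 * ψ q.2) * (ω q.1 q.2 * jpp (ω q.1 q.2) * dX ω q.1 q.2) =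
        -∫ q in Ioc 0 L ×ˢ univ, (dX u q.1 q.2 * ψ q.2) * G (ω q.1 q.2) := by
      refine integral_strip_mul_dX_eq_neg hL.le (f := fun x y => u x y * ψ y) (g := fun x y => G (ω x y))
        (f' := fun x y => dX u x y * ψ y) (g' := fun x y => ω x y * jpp (ω x y) * dX ω x y)
        (fun x y => (hasDerivAt_dX_of_contDiff hu two_ne_zero x y).mul_const (ψ y)) hGx
        (fun y => by fun_prop) (fun y => by fun_prop) (fun y => ?_) ?_ ?_
      · have h1 := huper 0 y; have h2 := hωper 0 y
        rw [zero_add] at h1 h2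
        rw [h1, h2]
      · have := hIψ (fun q => u q.1 q.2 * (ω q.1 q.2 * jpp (ω q.1 q.2) * dX ω q.1 q.2)) (by fun_prop)
        refine this.congr_fun (fun q _ => ?_) (measurableSet_Ioc.prod MeasurableSet.univ)
        simp only; ring
      · have := hIψ (fun q => dX u q.1 q.2 * G (ω q.1 q.2)) (by fun_prop)
        refine this.congr_fun (fun q _ => ?_) (measurableSet_Ioc.prod MeasurableSet.univ)
        simp only; ring
    -- integration by parts in `y`: `∫∫ ((v − y)ψ) ∂_yG(ω) = −∫∫ ((∂_yv − 1)ψ + (v − y)ψ′) G(ω)`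
    have iby : ∫ q in Ioc 0 L ×ˢ univ, ((v q.1 q.2 - q.2) * ψ q.2) * (ω q.1 q.2 * jpp (ω q.1 q.2) * dY ω q.1 q.2) =
        -∫ q in Ioc 0 L ×ˢ univ, ((dY v q.1 q.2 - 1) * ψ q.2 + (v q.1 q.2 - q.2) * deriv ψ q.2) * G (ω q.1 q.2) := by
      refine integral_strip_mul_dY_eq_neg (f := fun x y => (v x y - y) * ψ y) (g := fun x y => G (ω x y))
        (f' := fun x y => (dY v x y - 1) * ψ y + (v x y - y) * deriv ψ y)
        (g' := fun x y => ω x y * jpp (ω x y) * dY ω x y)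
        (fun x y => ((hasDerivAt_dY_of_contDiff hv two_ne_zero x y).sub (hasDerivAt_id y)).mul (hψd y))
        hGy ?_ ?_ ?_
      · have := hIψ (fun q => (v q.1 q.2 - q.2) * (ω q.1 q.2 * jpp (ω q.1 q.2) * dY ω q.1 q.2)) (by fun_prop)
        refine this.congr_fun (fun q _ => ?_) (measurableSet_Ioc.prod MeasurableSet.univ)
        simp only; ring
      · have h1 := hIψ (fun q => (dY v q.1 q.2 - 1) * G (ω q.1 q.2)) (by fun_prop)
        have h2 := hIψ' (fun q => (v q.1 q.2 - q.2) * G (ω q.1 q.2)) (by fun_prop)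
        have h12 : IntegrableOn (fun q : ℝ × ℝ => (dY v q.1 q.2 - 1) * G (ω q.1 q.2) * ψ q.2 +
            (v q.1 q.2 - q.2) * G (ω q.1 q.2) * deriv ψ q.2) (Ioc 0 L ×ˢ univ) := h1.add h2
        refine h12.congr_fun (fun q _ => ?_) (measurableSet_Ioc.prod MeasurableSet.univ)
        simp only; ring
      · have := hIψ (fun q => (v q.1 q.2 - q.2) * G (ω q.1 q.2)) (by fun_prop)
        refine this.congr_fun (fun q _ => ?_) (measurableSet_Ioc.prod MeasurableSet.univ)
        simp only; ring
    -- integrability of the four pieces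
    have iA : IntegrableOn (fun q : ℝ × ℝ => (u q.1 q.2 * ψ q.2) * (ω q.1 q.2 * jpp (ω q.1 q.2) * dX ω q.1 q.2))
        (Ioc 0 L ×ˢ univ) := by
      have := hIψ (fun q => u q.1 q.2 * (ω q.1 q.2 * jpp (ω q.1 q.2) * dX ω q.1 q.2)) (by fun_prop)
      refine this.congr_fun (fun q _ => ?_) (measurableSet_Ioc.prod MeasurableSet.univ)
      simp only; ring
    have iB : IntegrableOn (fun q : ℝ × ℝ => ((v q.1 q.2 - q.2) * ψ q.2) * (ω q.1 q.2 * jpp (ω q.1 q.2) * dY ω q.1 q.2))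
        (Ioc 0 L ×ˢ univ) := by
      have := hIψ (fun q => (v q.1 q.2 - q.2) * (ω q.1 q.2 * jpp (ω q.1 q.2) * dY ω q.1 q.2)) (by fun_prop)
      refine this.congr_fun (fun q _ => ?_) (measurableSet_Ioc.prod MeasurableSet.univ)
      simp only; ring
    have iC : IntegrableOn (fun q : ℝ × ℝ => ω q.1 q.2 * jp (ω q.1 q.2) * (v q.1 q.2 - q.2) * deriv ψ q.2)
        (Ioc 0 L ×ˢ univ) := hIψ' (fun q => ω q.1 q.2 * jp (ω q.1 q.2) * (v q.1 q.2 - q.2)) (by fun_prop)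
    have iD : IntegrableOn (fun q : ℝ × ℝ => (dX u q.1 q.2 * ψ q.2) * G (ω q.1 q.2)) (Ioc 0 L ×ˢ univ) := by
      have := hIψ (fun q => dX u q.1 q.2 * G (ω q.1 q.2)) (by fun_prop)
      refine this.congr_fun (fun q _ => ?_) (measurableSet_Ioc.prod MeasurableSet.univ)
      simp only; ring
    have iE : IntegrableOn (fun q : ℝ × ℝ => ((dY v q.1 q.2 - 1) * ψ q.2 + (v q.1 q.2 - q.2) * deriv ψ q.2) *
        G (ω q.1 q.2)) (Ioc 0 L ×ˢ univ) := by
      have h1 := hIψ (fun q => (dY v q.1 q.2 - 1) * G (ω q.1 q.2)) (by fun_prop)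
      have h2 := hIψ' (fun q => (v q.1 q.2 - q.2) * G (ω q.1 q.2)) (by fun_prop)
      have h12 : IntegrableOn (fun q : ℝ × ℝ => (dY v q.1 q.2 - 1) * G (ω q.1 q.2) * ψ q.2 +
          (v q.1 q.2 - q.2) * G (ω q.1 q.2) * deriv ψ q.2) (Ioc 0 L ×ˢ univ) := h1.add h2
      refine h12.congr_fun (fun q _ => ?_) (measurableSet_Ioc.prod MeasurableSet.univ)
      simp only; ring
    have iP : IntegrableOn (fun q : ℝ × ℝ => G (ω q.1 q.2) * ψ q.2) (Ioc 0 L ×ˢ univ) :=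
      hIψ (fun q => G (ω q.1 q.2)) (by fun_prop)
    have iQ : IntegrableOn (fun q : ℝ × ℝ => Real.sqrt (ω q.1 q.2 ^ 2 + ε ^ 2) * (v q.1 q.2 - q.2) * deriv ψ q.2)
        (Ioc 0 L ×ˢ univ) :=
      hIψ' (fun q => Real.sqrt (ω q.1 q.2 ^ 2 + ε ^ 2) * (v q.1 q.2 - q.2)) (by fun_prop)
    have iR : IntegrableOn (fun q : ℝ × ℝ => (|ω q.1 q.2| + ε) * |v q.1 q.2 - q.2| * |deriv ψ q.2|)
        (Ioc 0 L ×ˢ univ) :=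
      kato_integrableOn_strip_of_eq_zero (R := R + 1) (by fun_prop) fun x _ y hy => by
        simp only [hψ'0 y hy, abs_zero, mul_zero]
    -- split the transport integrand
    have e1 : ∫ q in Ioc 0 L ×ˢ univ, ω q.1 q.2 * (u q.1 q.2 * dX Φ q.1 q.2 + (v q.1 q.2 - q.2) * dY Φ q.1 q.2) =
        (∫ q in Ioc 0 L ×ˢ univ, (u q.1 q.2 * ψ q.2) * (ω q.1 q.2 * jpp (ω q.1 q.2) * dX ω q.1 q.2)) +
        (∫ q in Ioc 0 L ×ˢ univ, ((v q.1 q.2 - q.2) * ψ q.2) * (ω q.1 q.2 * jpp (ω q.1 q.2) * dY ω q.1 q.2)) +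
        ∫ q in Ioc 0 L ×ˢ univ, ω q.1 q.2 * jp (ω q.1 q.2) * (v q.1 q.2 - q.2) * deriv ψ q.2 := by
      have iAB : IntegrableOn (fun q : ℝ × ℝ => (u q.1 q.2 * ψ q.2) * (ω q.1 q.2 * jpp (ω q.1 q.2) * dX ω q.1 q.2) +
          ((v q.1 q.2 - q.2) * ψ q.2) * (ω q.1 q.2 * jpp (ω q.1 q.2) * dY ω q.1 q.2)) (Ioc 0 L ×ˢ univ) := iA.add iB
      rw [← integral_add iA iB, ← integral_add iAB iC]
      refine integral_congr_ae (Eventually.of_forall fun q => ?_)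
      simp only
      rw [hΦx, hΦy]
      ring
    -- recombine after the integrations by parts
    have e2 : (-∫ q in Ioc 0 L ×ˢ univ, (dX u q.1 q.2 * ψ q.2) * G (ω q.1 q.2)) +
        (-∫ q in Ioc 0 L ×ˢ univ, ((dY v q.1 q.2 - 1) * ψ q.2 + (v q.1 q.2 - q.2) * deriv ψ q.2) * G (ω q.1 q.2)) +
        (∫ q in Ioc 0 L ×ˢ univ, ω q.1 q.2 * jp (ω q.1 q.2) * (v q.1 q.2 - q.2) * deriv ψ q.2) =
        (∫ q in Ioc 0 L ×ˢ univ, G (ω q.1 q.2) * ψ q.2) +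
          ∫ q in Ioc 0 L ×ˢ univ, Real.sqrt (ω q.1 q.2 ^ 2 + ε ^ 2) * (v q.1 q.2 - q.2) * deriv ψ q.2 := by
      have iDE : IntegrableOn (fun q : ℝ × ℝ => -((dX u q.1 q.2 * ψ q.2) * G (ω q.1 q.2)) +
          -(((dY v q.1 q.2 - 1) * ψ q.2 + (v q.1 q.2 - q.2) * deriv ψ q.2) * G (ω q.1 q.2))) (Ioc 0 L ×ˢ univ) :=
        iD.neg.add iE.neg
      have iDEC : IntegrableOn (fun q : ℝ × ℝ => -((dX u q.1 q.2 * ψ q.2) * G (ω q.1 q.2)) +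
          -(((dY v q.1 q.2 - 1) * ψ q.2 + (v q.1 q.2 - q.2) * deriv ψ q.2) * G (ω q.1 q.2)) +
          ω q.1 q.2 * jp (ω q.1 q.2) * (v q.1 q.2 - q.2) * deriv ψ q.2) (Ioc 0 L ×ˢ univ) := iDE.add iC
      have iDn : IntegrableOn (fun q : ℝ × ℝ => -((dX u q.1 q.2 * ψ q.2) * G (ω q.1 q.2))) (Ioc 0 L ×ˢ univ) :=
        iD.neg
      have iEn : IntegrableOn (fun q : ℝ × ℝ => -(((dY v q.1 q.2 - 1) * ψ q.2 + (v q.1 q.2 - q.2) * deriv ψ q.2) *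
          G (ω q.1 q.2))) (Ioc 0 L ×ˢ univ) := iE.neg
      rw [← integral_neg, ← integral_neg, ← integral_add iDn iEn, ← integral_add iDE iC,
        ← integral_add iP iQ]
      refine integral_congr_ae (Eventually.of_forall fun q => ?_)
      simp only
      have h1 : dX u q.1 q.2 + dY v q.1 q.2 = 0 := hdiv q.1 q.2
      have h2 := kato_mul_jprime_sub_G hε (ω q.1 q.2)
      simp only [hjp, hG] at h2 ⊢
      have h3 : dY v q.1 q.2 = -dX u q.1 q.2 := by linarith
      rw [h3]
      linear_combination (v q.1 q.2 - q.2) * deriv ψ q.2 * h2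
    rw [e1, ibx, iby]
    linarith [e2]
  ------------------------------------------------------------------
  -- the viscous part
  ------------------------------------------------------------------
  have hV : ∫ q in Ioc 0 L ×ˢ univ, (dX ω q.1 q.2 * dX Φ q.1 q.2 + dY ω q.1 q.2 * dY Φ q.1 q.2) =
      (∫ q in Ioc 0 L ×ˢ univ, jpp (ω q.1 q.2) * (dX ω q.1 q.2 ^ 2 + dY ω q.1 q.2 ^ 2) * ψ q.2) +
        ∫ q in Ioc 0 L ×ˢ univ, jp (ω q.1 q.2) * dY ω q.1 q.2 * deriv ψ q.2 := by
    rw [← integral_add (hIψ _ (by fun_prop)) (hIψ' _ (by fun_prop))]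
    refine integral_congr_ae (Eventually.of_forall fun q => ?_)
    simp only
    rw [hΦx, hΦy]
    ring
  -- conclusion
  rw [hT, hV]
  ring

end KatoWeighted

/-! ## The weight `φ(y) = √(1 + y²)` -/

section Weight

/-- **The weight `φ(y) = √(1 + y²)` (bundled):** `φ > 0`, `|y| ≤ φ`, `φ ≤ 1 + |y|`, `|φ′| = |y/φ| ≤ 1`,
`|φ″| = |1/φ³| ≤ 1`, `yφ′ = φ − 1/φ`, `φ, φ′ ∈ C¹`, `φ ≥ 1`, `φ² = 1 + y²`, `φ′ = y/φ`, `(y/φ)′ = 1/φ³`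
(from the tree's `Seregin2020.sqrt_one_add_sq_props`). Consumers destructure it with the component names
`kato_phi_pos, kato_abs_le_phi, kato_phi_le, kato_abs_phi'_le, kato_phi''_le, kato_mul_phi', kato_phi_contDiff,
kato_phi'_contDiff, kato_phi_ge_one, kato_phi_sq, kato_hasDerivAt_phi, kato_hasDerivAt_phi'`. [folklore] -/
theorem kato_phi_props :
    (∀ y : ℝ, 0 < Real.sqrt (1 + y ^ 2)) ∧ (∀ y : ℝ, |y| ≤ Real.sqrt (1 + y ^ 2)) ∧
    (∀ y : ℝ, Real.sqrt (1 + y ^ 2) ≤ 1 + |y|) ∧ (∀ y : ℝ, |y / Real.sqrt (1 + y ^ 2)| ≤ 1) ∧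
    (∀ y : ℝ, |1 / Real.sqrt (1 + y ^ 2) ^ 3| ≤ 1) ∧
    (∀ y : ℝ, y * (y / Real.sqrt (1 + y ^ 2)) = Real.sqrt (1 + y ^ 2) - 1 / Real.sqrt (1 + y ^ 2)) ∧
    ContDiff ℝ 1 (fun y : ℝ => Real.sqrt (1 + y ^ 2)) ∧ ContDiff ℝ 1 (fun y : ℝ => y / Real.sqrt (1 + y ^ 2)) ∧
    (∀ y : ℝ, 1 ≤ Real.sqrt (1 + y ^ 2)) ∧ (∀ y : ℝ, Real.sqrt (1 + y ^ 2) ^ 2 = 1 + y ^ 2) ∧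
    (∀ y : ℝ, HasDerivAt (fun y => Real.sqrt (1 + y ^ 2)) (y / Real.sqrt (1 + y ^ 2)) y) ∧
    (∀ y : ℝ, HasDerivAt (fun y => y / Real.sqrt (1 + y ^ 2)) (1 / Real.sqrt (1 + y ^ 2) ^ 3) y) := by
  obtain ⟨hge, hsq, -, hC, hd1, hd2⟩ := Seregin2020.sqrt_one_add_sq_props
  have hpos : ∀ y : ℝ, 0 < Real.sqrt (1 + y ^ 2) := fun y => one_pos.trans_le (hge y)
  have habs : ∀ y : ℝ, |y| ≤ Real.sqrt (1 + y ^ 2) := fun y => Real.abs_le_sqrt (by nlinarith)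
  have hle : ∀ y : ℝ, Real.sqrt (1 + y ^ 2) ≤ 1 + |y| := fun y => by
    rw [Real.sqrt_le_iff]; exact ⟨by positivity, by nlinarith [abs_nonneg y, sq_abs y]⟩
  have hC1 : ContDiff ℝ 1 (fun y : ℝ => Real.sqrt (1 + y ^ 2)) := hC.of_le (by exact_mod_cast le_top)
  refine ⟨hpos, habs, hle, fun y => ?_, fun y => ?_, fun y => ?_, hC1, ?_, hge, hsq, hd1, hd2⟩
  · rw [abs_div, abs_of_pos (hpos y), div_le_one (hpos y)]; exact habs y
  · rw [abs_of_nonneg (by positivity), div_le_one (by positivity)]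
    calc (1:ℝ) = 1 ^ 3 := by norm_num
      _ ≤ Real.sqrt (1 + y ^ 2) ^ 3 := pow_le_pow_left₀ zero_le_one (hge y) 3
  · have hφ := hpos y
    have h2 := hsq y
    field_simp
    nlinarith [h2]
  · exact contDiff_id.div hC1 fun y => (hpos y).ne'

end Weight

end Summit.AnomalousDissipation.AnomalousDissipation.Theorems.StrainedLayerLaw.StrainWorkSumRule

end
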